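import Summits.QuantumFields.YangMills.Theorems.BalabanUVNodesN19CoreTVInvariant
import Literature.MathematicalPhysics.QuantumFieldTheory.Balaban1983to89.T4PathVarianceRate
import Mathlib.MeasureTheory.Measure.Decomposition.Hahn

/-!
# BalabanUVNodes ∕ N19 — THE SHARP TOTAL-VARIATION ⇒ TILTED-LAW ∕ TILTED-MEAN CONSTANT (I: the inequality)

Cell `pub-ymgap` (HUMAN RULING D-0062 Track A; D-0149 width seats), node N19 = NE7 (→ N14's binder), WIDTH SEAT `pub-ymgap-dag-n19-w2`
(g3; bus CLAIM-1 ∕ INTENT-1 INBOX l.27645, split 1a∕1b under the 400-line rule).  The successor piece this seat's g2 named for its own landed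
U3-face-for-N14 TV edition (`…N19ShapeFaceN14AtRecordTV`, p585100): «a SHARP TV ⇒ tilted-mean engine — n19-c's `tiltedMeanMatching_of_tv` is at
`4B·e^{2l₀B}·ρ`; none sharper in tree».  Filed `--kind proof --supports` K3⁷ `SpineGivenEndpointR13SepCoPH` = stmt-QuantumFields-20544 `--as helper`.
COUNT-NEUTRAL.  THEOREMS ONLY (0 `def`: the sharp rate `κρ ∕ (1 + (κ − 1)ρ)` is SPELLED OUT everywhere); imports n19-c's `…N19CoreTVInvariant` (hence
`…N19TVCurrency.abs_integral_sub_integral_le_of_tv`), the Literature leaf `T4PathVarianceRate` (its dictionary `measureReal_tilted_eq_div`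
`(μ.tilted f).real S = ∫_S e^{f} dμ ∕ ∫ e^{f} dμ`, BY NAME) and Mathlib's Hahn decomposition; edits nothing, re-declares nothing.  «TV» = closeness of two
probability laws on every measurable SET (n19-c's reference-measure-free letters, verbatim).  Companion file 1b `…N19TVTiltSharpLeaf`: the EXTREMAL
WITNESS (the constant below is attained) and the class-level `TiltedMeanMatching` faces.

THE ONE NEW THING.  Two probability laws `ν₁, ν₂` that are `ρ`-close on every measurable set, and a tilt `e^{f}` with `|f| ≤ c` (`κ := e^{2c}`): the
TILTED laws `νᵢ.tilted f` (Mathlib `Measure.tilted`) are `κρ ∕ (1 + (κ − 1)ρ)`-close on every measurable set (§2), hence the tilted means of any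
measurable `|F| ≤ B` at tilt `s` (`κ = e^{2|s|B}`) are `2B·κρ ∕ (1 + (κ − 1)ρ) ≤ 2B·κρ`-close (§3) — HALF the tree's `4B·κρ`
(`N19TVCurrency.abs_tiltedMean_sub_tiltedMean_le_of_tv`), and OPTIMAL (file 1b `tv_tilt_sharp_toy`: a two-point pair attains it at every `(B, s, ρ)`).

MECHANISM (§2).  Hahn set `D` for `(ν₁, ν₂)` (`ν₁ ≥ ν₂` on the measurable subsets of `D`, `ν₁ ≤ ν₂` on those of `Dᶜ`; Mathlib `hahn_decomposition`).
With `h = e^{f} ∈ [a, b]`, `a = e^{−c}`, `b = e^{c}`, `ρ′ := ν₁(D) − ν₂(D) ∈ [0, ρ]`: the COMMON PART `λ := ν₁|Dᶜ + ν₂|D` has `U := λ(h) ≥ a(1 − ρ′)` and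
`u := λ(h·1_S) ∈ [0, U]`; the EXCESSES `p := ∫_D h d(ν₁ − ν₂) ≤ bρ′`, `q := ∫_{Dᶜ} h d(ν₂ − ν₁) ≤ bρ′` and their `S`-parts `p_S ≤ p`, `0 ≤ q_S`;
`∫h dν₁ = U + p`, `∫_S h dν₁ = u + p_S`, `∫h dν₂ = U + q`, `∫_S h dν₂ = u + q_S`.  The five-letter real inequality
`(u + p_S)∕(U + p) − (u + q_S)∕(U + q) ≤ bρ′ ∕ (a(1 − ρ′) + bρ′)` (§1 `div_sub_div_le_of_hahnLetters`) is `κρ′ ∕ (1 + (κ − 1)ρ′)` (`sharpTiltRate_exp`),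
increasing in `ρ′ ≤ ρ` (`sharpTiltRate_mono`).

WHAT IS PROVED ([folklore]-grade measure ∕ real arithmetic; the optimal constant is the content).
* §1 (reals) `div_sub_div_le_of_hahnLetters` · `sharpTiltRate_nonneg` · `sharpTiltRate_mono` (in `ρ`, `κ ≥ 1`) · `sharpTiltRate_mono_kappa` (in `κ`, for
  `ρ ≤ 1`) · `sharpTiltRate_le_linear` (`≤ κρ`) · `sharpTiltRate_le_one` (`ρ ≤ 1`) · `one_le_sharpTiltRate` (`ρ ≥ 1`) · `sharpTiltRate_exp`.
* §2 `restrict_le_restrict_of_hahn` · ★★ `tilted_real_sub_tilted_real_le_of_tv` (one-sided) · ★★ `abs_tilted_real_sub_tilted_real_le_of_tv` (TV `ρ` ⇒ TV of the `f`-tilted laws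
  `≤ e^{2c}ρ ∕ (1 + (e^{2c} − 1)ρ)`).
* §3 ★★ `abs_tiltedMean_sub_tiltedMean_le_of_tv_sharp` (`≤ 2B·e^{2|s|B}ρ ∕ (1 + (e^{2|s|B} − 1)ρ)`) · ★ `abs_tiltedMean_sub_tiltedMean_le_of_tv_half`
  (`≤ 2B·e^{2|s|B}·ρ`).
NEAREST TREE ART, CITED NOT RESTATED: n19-c `N19TVCurrency.abs_tiltedMean_sub_tiltedMean_le_of_tv` (`4B·e^{2|s|B}·ρ`, centring argument, no Hahn set);
n19-c `N19TiltPathEndpoints.abs_tilted_real_sub_le_of_pathOsc` (TV of ONE law's tilts along a tilt PATH from the path's L¹-oscillation — a different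
statement); ne1 gen 5 `TiltedMeanVisibilityTwoRun.abs_tiltedMean_comp_sub_comp_le` (L¹-ledger form w.r.t. a reference measure).

HONEST FRAMING.  Elementary; hypothesis shapes only (TV_cl is produced by nobody); ZERO Bałaban content; discharges nothing; NE7 ∕ NE1′ NOT PRINTED as
two-run statements for d = 4 and NOT proved; N14 ∕ N19 NOT discharged; K3⁷ OPEN, not claimed; counts UNMOVED (typed 28∕28 · discharged 5∕27 · A 5∕28);
no count claim.  One finite four-torus programme at fixed `ε`; R4 closes the conditional finite-𝕋⁴ rung `BalabanLadder.UV` only — NOT ℝ⁴, NOT OS, NOT the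
Yang–Mills mass gap, NOT Clay.  0 `def`; 0 `sorry`; standard axioms.
-/

set_option autoImplicit false

noncomputable section

open MeasureTheory ProbabilityTheory
open scoped ENNReal

namespace Summit.QuantumFields.YangMills.BalabanUVNodes.N19TVTiltSharp

open Summit.QuantumFields.BalabanUV.T4Continuum.NE1p.DressedMGFForm (tiltedMean TiltedMeanMatching)
open Summit.QuantumFields.BalabanUV.T4Continuum.NE1p.TiltedMeanInfluence (abs_tiltedMean_le)
open Summit.QuantumFields.YangMills.BalabanUVNodes.N19TVCurrency (abs_integral_sub_integral_le_of_tv)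
open Literature.MathematicalPhysics.QuantumFieldTheory.Balaban1983to89.T4PathVarianceRate (measureReal_tilted_eq_div)

/-! ## §1 Real arithmetic: the five Hahn letters and the sharp rate `κρ ∕ (1 + (κ − 1)ρ)` [folklore] -/

/-- **THE FIVE-LETTER CORE.**  Common part `0 ≤ u ≤ U` with `a(1 − ρ′) ≤ U`, excesses `p_S ≤ p ≤ bρ′`, `0 ≤ q_S`, `q ≤ bρ′`, positive totals
`U + p`, `U + q`, `0 < a ≤ b`, `0 ≤ ρ′`:  `(u + p_S)∕(U + p) − (u + q_S)∕(U + q) ≤ bρ′ ∕ (a(1 − ρ′) + bρ′)`.  Chain: drop `q_S`, raise `p_S` to `p`, raise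
`q` and `p` to `bρ′` (`t ↦ (u + t)∕(U + t)` increases for `u ≤ U`), lower `U` to `a(1 − ρ′)`. [folklore] -/
theorem div_sub_div_le_of_hahnLetters {a b U u p pS q qS ρ' : ℝ} (ha : 0 < a) (hab : a ≤ b) (hu0 : 0 ≤ u) (huU : u ≤ U)
    (hU : a * (1 - ρ') ≤ U) (hρ'0 : 0 ≤ ρ') (hpSp : pS ≤ p) (hp : p ≤ b * ρ') (hqS0 : 0 ≤ qS) (hq : q ≤ b * ρ')
    (hZ1 : 0 < U + p) (hZ2 : 0 < U + q) :
    (u + pS) / (U + p) - (u + qS) / (U + q) ≤ b * ρ' / (a * (1 - ρ') + b * ρ') := by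
  have hb : 0 < b := ha.trans_le hab
  have hbρ : 0 ≤ b * ρ' := mul_nonneg hb.le hρ'0
  have hD0 : 0 < a * (1 - ρ') + b * ρ' := by nlinarith
  have hUb : 0 < U + b * ρ' := by linarith
  -- (1) drop `q_S`, and lower `(u + p_S)` is raised to `(u + p)`
  have h1 : (u + pS) / (U + p) ≤ (u + p) / (U + p) := div_le_div_of_nonneg_right (by linarith) hZ1.le
  have h2 : u / (U + b * ρ') ≤ (u + qS) / (U + q) :=
    calc u / (U + b * ρ') ≤ u / (U + q) := div_le_div_of_nonneg_left hu0 hZ2 (by linarith)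
      _ ≤ (u + qS) / (U + q) := div_le_div_of_nonneg_right (by linarith) hZ2.le
  -- (2) `t ↦ (u + t)∕(U + t)` is increasing for `u ≤ U`
  have h3 : (u + p) / (U + p) ≤ (u + b * ρ') / (U + b * ρ') := by
    rw [div_le_div_iff₀ hZ1 hUb]
    nlinarith [mul_nonneg (sub_nonneg.2 hp) (sub_nonneg.2 huU)]
  -- (3) the difference at `t = bρ′` and the lower bound on `U`
  have h4 : (u + b * ρ') / (U + b * ρ') - u / (U + b * ρ') = b * ρ' / (U + b * ρ') := by
    rw [← sub_div]; ring_nf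
  have h5 : b * ρ' / (U + b * ρ') ≤ b * ρ' / (a * (1 - ρ') + b * ρ') := div_le_div_of_nonneg_left hbρ hD0 (by linarith)
  linarith

/-- The sharp rate is non-negative (`κ ≥ 1`, `ρ ≥ 0`). [folklore] -/
theorem sharpTiltRate_nonneg {κ ρ : ℝ} (hκ : 1 ≤ κ) (hρ : 0 ≤ ρ) : 0 ≤ κ * ρ / (1 + (κ - 1) * ρ) :=
  div_nonneg (mul_nonneg (zero_le_one.trans hκ) hρ) (by nlinarith [mul_nonneg (sub_nonneg.2 hκ) hρ])

/-- The sharp rate `κρ ∕ (1 + (κ − 1)ρ)` is INCREASING in `ρ ≥ 0` (`κ ≥ 1`). [folklore] -/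
theorem sharpTiltRate_mono {κ ρ ρ' : ℝ} (hκ : 1 ≤ κ) (hρ : 0 ≤ ρ) (hle : ρ ≤ ρ') :
    κ * ρ / (1 + (κ - 1) * ρ) ≤ κ * ρ' / (1 + (κ - 1) * ρ') := by
  have h1 : 0 < 1 + (κ - 1) * ρ := by nlinarith [mul_nonneg (sub_nonneg.2 hκ) hρ]
  have h2 : 0 < 1 + (κ - 1) * ρ' := by nlinarith [mul_nonneg (sub_nonneg.2 hκ) (hρ.trans hle)]
  rw [div_le_div_iff₀ h1 h2]
  have hid : κ * ρ * (1 + (κ - 1) * ρ') = κ * ρ' * (1 + (κ - 1) * ρ) + κ * (ρ - ρ') := by ring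
  rw [hid]
  nlinarith [mul_nonneg (zero_le_one.trans hκ) (sub_nonneg.2 hle)]

/-- The sharp rate is INCREASING in `κ ≥ 1` when `ρ ∈ [0, 1]` (so the tilt window's END `|s| = l₀` is the worst tilt). [folklore] -/
theorem sharpTiltRate_mono_kappa {κ κ' ρ : ℝ} (hκ : 1 ≤ κ) (hle : κ ≤ κ') (hρ : 0 ≤ ρ) (hρ1 : ρ ≤ 1) :
    κ * ρ / (1 + (κ - 1) * ρ) ≤ κ' * ρ / (1 + (κ' - 1) * ρ) := by
  have h1 : 0 < 1 + (κ - 1) * ρ := by nlinarith [mul_nonneg (sub_nonneg.2 hκ) hρ]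
  have h2 : 0 < 1 + (κ' - 1) * ρ := by nlinarith [mul_nonneg (sub_nonneg.2 (hκ.trans hle)) hρ]
  rw [div_le_div_iff₀ h1 h2]
  have hid : κ * ρ * (1 + (κ' - 1) * ρ) = κ' * ρ * (1 + (κ - 1) * ρ) + (κ - κ') * (ρ * (1 - ρ)) := by ring
  rw [hid]
  nlinarith [mul_nonneg (sub_nonneg.2 hle) (mul_nonneg hρ (sub_nonneg.2 hρ1))]

/-- The sharp rate is below the LINEAR rate `κρ` (`κ ≥ 1`, `ρ ≥ 0`). [folklore] -/
theorem sharpTiltRate_le_linear {κ ρ : ℝ} (hκ : 1 ≤ κ) (hρ : 0 ≤ ρ) : κ * ρ / (1 + (κ - 1) * ρ) ≤ κ * ρ :=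
  div_le_self (mul_nonneg (zero_le_one.trans hκ) hρ) (by nlinarith [mul_nonneg (sub_nonneg.2 hκ) hρ])

/-- The sharp rate is `≤ 1` for `ρ ≤ 1` (the tilted laws are probability laws). [folklore] -/
theorem sharpTiltRate_le_one {κ ρ : ℝ} (hκ : 1 ≤ κ) (hρ : 0 ≤ ρ) (hρ1 : ρ ≤ 1) : κ * ρ / (1 + (κ - 1) * ρ) ≤ 1 := by
  have h1 : 0 < 1 + (κ - 1) * ρ := by nlinarith [mul_nonneg (sub_nonneg.2 hκ) hρ]
  rw [div_le_one h1]
  nlinarith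

/-- The sharp rate is `≥ 1` for `ρ ≥ 1` (so `2B`· it dominates the trivial bound there). [folklore] -/
theorem one_le_sharpTiltRate {κ ρ : ℝ} (hκ : 1 ≤ κ) (hρ1 : 1 ≤ ρ) : 1 ≤ κ * ρ / (1 + (κ - 1) * ρ) := by
  have h1 : 0 < 1 + (κ - 1) * ρ := by nlinarith [mul_nonneg (sub_nonneg.2 hκ) (zero_le_one.trans hρ1)]
  rw [one_le_div h1]
  nlinarith

/-- The Hahn letters `(a, b) = (e^{−c}, e^{c})` give the rate at `κ = e^{2c}`:  `bρ′ ∕ (a(1 − ρ′) + bρ′) = e^{2c}ρ′ ∕ (1 + (e^{2c} − 1)ρ′)`. [folklore] -/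
theorem sharpTiltRate_exp (c ρ' : ℝ) :
    Real.exp c * ρ' / (Real.exp (-c) * (1 - ρ') + Real.exp c * ρ') = Real.exp (2 * c) * ρ' / (1 + (Real.exp (2 * c) - 1) * ρ') := by
  have hκ : Real.exp c * Real.exp c = Real.exp (2 * c) := by rw [← Real.exp_add]; ring_nf
  have h1 : Real.exp c * Real.exp (-c) = 1 := by rw [← Real.exp_add, add_neg_cancel, Real.exp_zero]
  rw [← mul_div_mul_left (Real.exp c * ρ') _ (Real.exp_pos c).ne']
  congr 1
  · rw [← mul_assoc, hκ]
  · calc Real.exp c * (Real.exp (-c) * (1 - ρ') + Real.exp c * ρ')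
        = Real.exp c * Real.exp (-c) * (1 - ρ') + Real.exp c * Real.exp c * ρ' := by ring
      _ = 1 + (Real.exp (2 * c) - 1) * ρ' := by rw [h1, hκ]; ring

/-! ## §2 Two probability laws close on every SET ⇒ their TILTED laws close on every set, sharp constant [folklore] -/

section Tilted

variable {α : Type*} [MeasurableSpace α]

/-- A Hahn-type set inequality (`ν t ≤ μ t` for the measurable `t ⊆ D`) restricts: `ν|E ≤ μ|E` for every measurable `E ⊆ D`. [folklore] -/
theorem restrict_le_restrict_of_hahn {μ ν : Measure α} {D E : Set α} (hE : MeasurableSet E) (hED : E ⊆ D)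
    (h : ∀ t, MeasurableSet t → t ⊆ D → ν t ≤ μ t) : ν.restrict E ≤ μ.restrict E := by
  rw [Measure.le_iff]
  intro s hs
  rw [Measure.restrict_apply hs, Measure.restrict_apply hs]
  exact h _ (hs.inter hE) (Set.inter_subset_right.trans hED)

variable {ν₁ ν₂ : Measure α} [IsProbabilityMeasure ν₁] [IsProbabilityMeasure ν₂] {f : α → ℝ} {c ρ : ℝ}

/-- ★★ **SETS ⇒ TILTED SETS, ONE-SIDED, SHARP.**  Two probability laws `ρ`-close on every measurable set, a measurable tilt exponent `|f| ≤ c`: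
for every measurable `S`, `(ν₁.tilted f)(S) − (ν₂.tilted f)(S) ≤ e^{2c}ρ ∕ (1 + (e^{2c} − 1)ρ)`.  Hahn set of `(ν₁, ν₂)`, the five letters of the
header, §1 `div_sub_div_le_of_hahnLetters`, `sharpTiltRate_exp`, monotonicity in `ρ′ ≤ ρ`. [folklore] -/
theorem tilted_real_sub_tilted_real_le_of_tv (hfm : Measurable f) (hf : ∀ x, |f x| ≤ c)
    (hTV : ∀ S, MeasurableSet S → |ν₂.real S - ν₁.real S| ≤ ρ) {S : Set α} (hS : MeasurableSet S) :
    (ν₁.tilted f).real S - (ν₂.tilted f).real S ≤ Real.exp (2 * c) * ρ / (1 + (Real.exp (2 * c) - 1) * ρ) := by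
  obtain ⟨x₀, -⟩ := nonempty_of_measure_ne_zero (μ := ν₁) (s := Set.univ) (by simp)
  have hc : 0 ≤ c := (abs_nonneg _).trans (hf x₀)
  have hρD : ∀ S, MeasurableSet S → ν₁.real S - ν₂.real S ≤ ρ := fun S hS' => by
    have := hTV S hS'; rw [abs_sub_comm] at this; exact (le_abs_self _).trans this
  -- the tilt `h = e^{f} ∈ [a, b]`
  set h : α → ℝ := fun x => Real.exp (f x) with hh
  set a : ℝ := Real.exp (-c) with ha_def
  set b : ℝ := Real.exp c with hb_def
  have ha : 0 < a := Real.exp_pos _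
  have hab : a ≤ b := Real.exp_le_exp.2 (by linarith)
  have hlo : ∀ x, a ≤ h x := fun x => Real.exp_le_exp.2 (abs_le.1 (hf x)).1
  have hhi : ∀ x, h x ≤ b := fun x => Real.exp_le_exp.2 (abs_le.1 (hf x)).2
  have hpos : ∀ x, 0 ≤ h x := fun x => (Real.exp_pos _).le
  have hm : Measurable h := hfm.exp
  have hint : ∀ (ν : Measure α) [IsProbabilityMeasure ν], Integrable h ν := fun ν _ =>
    (integrable_const b).mono' hm.aestronglyMeasurable
      (ae_of_all _ fun x => by rw [Real.norm_eq_abs, abs_of_nonneg (hpos x)]; exact hhi x)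
  have hintb : ∀ (ν : Measure α) [IsProbabilityMeasure ν], Integrable (fun x => b - h x) ν := fun ν _ =>
    (integrable_const b).sub (hint ν)
  -- Hahn set: `ν₁ ≥ ν₂` on the measurable subsets of `D`, `ν₁ ≤ ν₂` on those of `Dᶜ`
  obtain ⟨D, hDm, hD, hDc⟩ := hahn_decomposition ν₁ ν₂
  -- restricted comparisons
  have rD : ∀ {E : Set α}, MeasurableSet E → E ⊆ D → ν₂.restrict E ≤ ν₁.restrict E := fun hE hED =>
    restrict_le_restrict_of_hahn hE hED hD
  have rDc : ∀ {E : Set α}, MeasurableSet E → E ⊆ Dᶜ → ν₁.restrict E ≤ ν₂.restrict E := fun hE hED =>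
    restrict_le_restrict_of_hahn hE hED hDc
  have monoD : ∀ {E : Set α}, MeasurableSet E → E ⊆ D → ∫ x in E, h x ∂ν₂ ≤ ∫ x in E, h x ∂ν₁ := fun hE hED =>
    integral_mono_measure (rD hE hED) (ae_of_all _ hpos) (hint ν₁).integrableOn
  have monoDc : ∀ {E : Set α}, MeasurableSet E → E ⊆ Dᶜ → ∫ x in E, h x ∂ν₁ ≤ ∫ x in E, h x ∂ν₂ := fun hE hED =>
    integral_mono_measure (rDc hE hED) (ae_of_all _ hpos) (hint ν₂).integrableOn
  have monoD' : ∫ x in D, (b - h x) ∂ν₂ ≤ ∫ x in D, (b - h x) ∂ν₁ :=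
    integral_mono_measure (rD hDm subset_rfl) (ae_of_all _ fun x => sub_nonneg.2 (hhi x)) (hintb ν₁).integrableOn
  have monoDc' : ∫ x in Dᶜ, (b - h x) ∂ν₁ ≤ ∫ x in Dᶜ, (b - h x) ∂ν₂ :=
    integral_mono_measure (rDc hDm.compl subset_rfl) (ae_of_all _ fun x => sub_nonneg.2 (hhi x)) (hintb ν₂).integrableOn
  -- the letters
  have hsplit : ∀ (ν : Measure α) [IsProbabilityMeasure ν], ∫ x in D, h x ∂ν + ∫ x in Dᶜ, h x ∂ν = ∫ x, h x ∂ν := fun ν _ =>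
    integral_add_compl hDm (hint ν)
  have hsplitS : ∀ (ν : Measure α) [IsProbabilityMeasure ν], ∫ x in S ∩ D, h x ∂ν + ∫ x in S \ D, h x ∂ν = ∫ x in S, h x ∂ν :=
    fun ν _ => integral_inter_add_sdiff hDm (hint ν).integrableOn
  have hsplitD : ∀ (ν : Measure α) [IsProbabilityMeasure ν], ∫ x in D ∩ S, h x ∂ν + ∫ x in D \ S, h x ∂ν = ∫ x in D, h x ∂ν :=
    fun ν _ => integral_inter_add_sdiff hS (hint ν).integrableOn
  have hsub : ∀ (ν : Measure α) [IsProbabilityMeasure ν] (E : Set α), ∫ x in E, (b - h x) ∂ν = b * ν.real E - ∫ x in E, h x ∂ν :=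
    fun ν _ E => by
      rw [integral_sub (integrable_const b) (hint ν).integrableOn, setIntegral_const, smul_eq_mul, mul_comm]
  have hSD : S ∩ D = D ∩ S := Set.inter_comm _ _
  -- mass letters
  have hρ' : 0 ≤ ν₁.real D - ν₂.real D := by
    have := hD D hDm subset_rfl
    exact sub_nonneg.2 (ENNReal.toReal_mono (measure_ne_top _ _) this)
  have hρ'ρ : ν₁.real D - ν₂.real D ≤ ρ := hρD D hDm
  have hc1 : ν₁.real Dᶜ = 1 - ν₁.real D := probReal_compl_eq_one_sub hDm
  have hc2 : ν₂.real Dᶜ = 1 - ν₂.real D := probReal_compl_eq_one_sub hDm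
  -- lower bounds `∫_E h ≥ a·ν(E)`
  have hlow : ∀ (ν : Measure α) [IsProbabilityMeasure ν] (E : Set α), MeasurableSet E → a * ν.real E ≤ ∫ x in E, h x ∂ν :=
    fun ν _ E hE => by
      have := setIntegral_mono_on (integrable_const a).integrableOn (hint ν).integrableOn hE fun x _ => hlo x
      rwa [setIntegral_const, smul_eq_mul, mul_comm] at this
  -- non-negativity and monotonicity in the set
  have hnn : ∀ (ν : Measure α) (E : Set α), MeasurableSet E → 0 ≤ ∫ x in E, h x ∂ν := fun ν E hE =>
    setIntegral_nonneg hE fun x _ => hpos x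
  have hmonoS : ∀ (ν : Measure α) [IsProbabilityMeasure ν] {E E' : Set α}, E ⊆ E' → ∫ x in E, h x ∂ν ≤ ∫ x in E', h x ∂ν :=
    fun ν _ E E' hEE' => setIntegral_mono_set (hint ν).integrableOn (ae_of_all _ hpos) (ae_of_all _ hEE')
  -- the inequality in the five letters
  have key := div_sub_div_le_of_hahnLetters (a := a) (b := b)
    (U := ∫ x in Dᶜ, h x ∂ν₁ + ∫ x in D, h x ∂ν₂) (u := ∫ x in S \ D, h x ∂ν₁ + ∫ x in S ∩ D, h x ∂ν₂)
    (p := ∫ x in D, h x ∂ν₁ - ∫ x in D, h x ∂ν₂) (pS := ∫ x in S ∩ D, h x ∂ν₁ - ∫ x in S ∩ D, h x ∂ν₂)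
    (q := ∫ x in Dᶜ, h x ∂ν₂ - ∫ x in Dᶜ, h x ∂ν₁) (qS := ∫ x in S \ D, h x ∂ν₂ - ∫ x in S \ D, h x ∂ν₁)
    (ρ' := ν₁.real D - ν₂.real D) ha hab
    (add_nonneg (hnn ν₁ _ (hS.diff hDm)) (hnn ν₂ _ (hS.inter hDm)))
    (add_le_add (hmonoS ν₁ fun x hx => hx.2) (hmonoS ν₂ Set.inter_subset_right))
    (by
      have h₁ := hlow ν₁ Dᶜ hDm.compl; have h₂ := hlow ν₂ D hDm
      rw [hc1] at h₁; nlinarith)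
    hρ'
    (by
      have h₁ := hsplitD ν₁; have h₂ := hsplitD ν₂
      have h₃ := monoD (hDm.diff hS) fun x hx => hx.1
      rw [hSD]; linarith)
    (by
      have h₁ := hsub ν₁ D; have h₂ := hsub ν₂ D
      linarith [monoD'])
    (sub_nonneg.2 (monoDc (hS.diff hDm) fun x hx => hx.2))
    (by
      have h₁ := hsub ν₁ Dᶜ; have h₂ := hsub ν₂ Dᶜ
      rw [hc1] at h₁; rw [hc2] at h₂
      linarith [monoDc'])
    (by
      have h₁ := hsplit ν₁; have h₂ := hlow ν₁ Set.univ MeasurableSet.univ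
      rw [probReal_univ, mul_one, setIntegral_univ] at h₂; linarith)
    (by
      have h₁ := hsplit ν₂; have h₂ := hlow ν₂ Set.univ MeasurableSet.univ
      rw [probReal_univ, mul_one, setIntegral_univ] at h₂; linarith)
  -- read the letters back as the tilted masses
  have hZ1 : (∫ x in Dᶜ, h x ∂ν₁ + ∫ x in D, h x ∂ν₂) + (∫ x in D, h x ∂ν₁ - ∫ x in D, h x ∂ν₂) = ∫ x, h x ∂ν₁ := by
    have := hsplit ν₁; linarith
  have hZ2 : (∫ x in Dᶜ, h x ∂ν₁ + ∫ x in D, h x ∂ν₂) + (∫ x in Dᶜ, h x ∂ν₂ - ∫ x in Dᶜ, h x ∂ν₁) = ∫ x, h x ∂ν₂ := by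
    have := hsplit ν₂; linarith
  have hN1 : (∫ x in S \ D, h x ∂ν₁ + ∫ x in S ∩ D, h x ∂ν₂) + (∫ x in S ∩ D, h x ∂ν₁ - ∫ x in S ∩ D, h x ∂ν₂) =
      ∫ x in S, h x ∂ν₁ := by
    have := hsplitS ν₁; linarith
  have hN2 : (∫ x in S \ D, h x ∂ν₁ + ∫ x in S ∩ D, h x ∂ν₂) + (∫ x in S \ D, h x ∂ν₂ - ∫ x in S \ D, h x ∂ν₁) =
      ∫ x in S, h x ∂ν₂ := by
    have := hsplitS ν₂; linarith
  rw [hZ1, hZ2, hN1, hN2, sharpTiltRate_exp] at key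
  rw [measureReal_tilted_eq_div ν₁ f hS, measureReal_tilted_eq_div ν₂ f hS]
  exact key.trans (sharpTiltRate_mono (Real.one_le_exp (by linarith)) hρ' hρ'ρ)

/-- ★★ **SETS ⇒ TILTED SETS, SHARP.**  Two probability laws `ρ`-close on every measurable set, a measurable tilt exponent `|f| ≤ c`: the TILTED laws
are `e^{2c}ρ ∕ (1 + (e^{2c} − 1)ρ)`-close on every measurable set (both one-sided instances of the previous theorem; the hypothesis is symmetric).
Sharp: §4. [folklore] -/
theorem abs_tilted_real_sub_tilted_real_le_of_tv (hfm : Measurable f) (hf : ∀ x, |f x| ≤ c)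
    (hTV : ∀ S, MeasurableSet S → |ν₂.real S - ν₁.real S| ≤ ρ) {S : Set α} (hS : MeasurableSet S) :
    |(ν₂.tilted f).real S - (ν₁.tilted f).real S| ≤ Real.exp (2 * c) * ρ / (1 + (Real.exp (2 * c) - 1) * ρ) := by
  have hTV' : ∀ S, MeasurableSet S → |ν₁.real S - ν₂.real S| ≤ ρ := fun S hS' => by rw [abs_sub_comm]; exact hTV S hS'
  exact abs_sub_le_iff.2 ⟨tilted_real_sub_tilted_real_le_of_tv hfm hf hTV' hS, tilted_real_sub_tilted_real_le_of_tv hfm hf hTV hS⟩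

end Tilted

/-! ## §3 SETS ⇒ TILTED MEANS, sharp constant [folklore] -/

section TiltedMeans

variable {α : Type*} [MeasurableSpace α] {ν₁ ν₂ : Measure α} [IsProbabilityMeasure ν₁] [IsProbabilityMeasure ν₂] {F : α → ℝ} {B ρ : ℝ}

/-- ★★ **SETS ⇒ TILTED MEANS, SHARP.**  Two probability laws `ρ`-close on every measurable set have, for every measurable `|F| ≤ B` and every tilt `s`,
tilted means within `2B·κρ ∕ (1 + (κ − 1)ρ)`, `κ = e^{2|s|B}`:  the tilted laws are probability laws `κρ ∕ (1 + (κ − 1)ρ)`-close on sets (§2 at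
`f = sF`, `c = |s|B`), and `F ∈ [−B, B]` integrates within `2B`× that (n19-c `abs_integral_sub_integral_le_of_tv`).  HALF the tree's `4B·κρ` and optimal
(§4). [folklore] -/
theorem abs_tiltedMean_sub_tiltedMean_le_of_tv_sharp (hFm : Measurable F) (hF : ∀ x, |F x| ≤ B)
    (hTV : ∀ S, MeasurableSet S → |ν₂.real S - ν₁.real S| ≤ ρ) (s : ℝ) :
    |tiltedMean F ν₂ s - tiltedMean F ν₁ s| ≤
      2 * B * (Real.exp (2 * (|s| * B)) * ρ / (1 + (Real.exp (2 * (|s| * B)) - 1) * ρ)) := by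
  obtain ⟨x₀, -⟩ := nonempty_of_measure_ne_zero (μ := ν₁) (s := Set.univ) (by simp)
  have hB : 0 ≤ B := (abs_nonneg _).trans (hF x₀)
  have hsF : ∀ x, |s * F x| ≤ |s| * B := fun x => by
    rw [abs_mul]; exact mul_le_mul_of_nonneg_left (hF x) (abs_nonneg s)
  have hsFm : Measurable fun x => s * F x := measurable_const.mul hFm
  have hint : ∀ (ν : Measure α) [IsProbabilityMeasure ν], Integrable (fun x => Real.exp (s * F x)) ν := fun ν _ =>
    (integrable_const (Real.exp (|s| * B))).mono' hsFm.exp.aestronglyMeasurable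
      (ae_of_all _ fun x => by
        rw [Real.norm_eq_abs, abs_of_pos (Real.exp_pos _)]
        exact Real.exp_le_exp.2 (abs_le.1 (hsF x)).2)
  haveI : IsProbabilityMeasure (ν₁.tilted fun x => s * F x) := isProbabilityMeasure_tilted (hint ν₁)
  haveI : IsProbabilityMeasure (ν₂.tilted fun x => s * F x) := isProbabilityMeasure_tilted (hint ν₂)
  have hTVt : ∀ S, MeasurableSet S →
      |(ν₂.tilted fun x => s * F x).real S - (ν₁.tilted fun x => s * F x).real S| ≤
        Real.exp (2 * (|s| * B)) * ρ / (1 + (Real.exp (2 * (|s| * B)) - 1) * ρ) := fun S hS =>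
    abs_tilted_real_sub_tilted_real_le_of_tv hsFm hsF hTV hS
  have h := abs_integral_sub_integral_le_of_tv (ν₁ := ν₁.tilted fun x => s * F x) (ν₂ := ν₂.tilted fun x => s * F x)
    (m := -B) (M := B) hFm (fun x => (abs_le.1 (hF x)).1) (fun x => (abs_le.1 (hF x)).2) (by linarith) hTVt
  unfold tiltedMean
  calc |∫ ω, F ω ∂(ν₂.tilted fun ω => s * F ω) - ∫ ω, F ω ∂(ν₁.tilted fun ω => s * F ω)|
      ≤ (B - -B) * (Real.exp (2 * (|s| * B)) * ρ / (1 + (Real.exp (2 * (|s| * B)) - 1) * ρ)) := h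
    _ = 2 * B * (Real.exp (2 * (|s| * B)) * ρ / (1 + (Real.exp (2 * (|s| * B)) - 1) * ρ)) := by ring

/-- ★ **… AND THE LINEAR MAJORANT `2B·e^{2|s|B}·ρ`** — HALF n19-c's `abs_tiltedMean_sub_tiltedMean_le_of_tv` (`sharpTiltRate_le_linear`). [folklore] -/
theorem abs_tiltedMean_sub_tiltedMean_le_of_tv_half (hFm : Measurable F) (hF : ∀ x, |F x| ≤ B)
    (hTV : ∀ S, MeasurableSet S → |ν₂.real S - ν₁.real S| ≤ ρ) (s : ℝ) :
    |tiltedMean F ν₂ s - tiltedMean F ν₁ s| ≤ 2 * B * Real.exp (2 * (|s| * B)) * ρ := by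
  obtain ⟨x₀, -⟩ := nonempty_of_measure_ne_zero (μ := ν₁) (s := Set.univ) (by simp)
  have hB : 0 ≤ B := (abs_nonneg _).trans (hF x₀)
  have hρ : 0 ≤ ρ := (abs_nonneg _).trans (hTV ∅ MeasurableSet.empty)
  have hκ : 1 ≤ Real.exp (2 * (|s| * B)) := Real.one_le_exp (by positivity)
  calc |tiltedMean F ν₂ s - tiltedMean F ν₁ s|
      ≤ 2 * B * (Real.exp (2 * (|s| * B)) * ρ / (1 + (Real.exp (2 * (|s| * B)) - 1) * ρ)) :=
        abs_tiltedMean_sub_tiltedMean_le_of_tv_sharp hFm hF hTV s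
    _ ≤ 2 * B * (Real.exp (2 * (|s| * B)) * ρ) := mul_le_mul_of_nonneg_left (sharpTiltRate_le_linear hκ hρ) (by positivity)
    _ = 2 * B * Real.exp (2 * (|s| * B)) * ρ := by ring

end TiltedMeans

end Summit.QuantumFields.YangMills.BalabanUVNodes.N19TVTiltSharp

end
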